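import Summits.QuantumFields.YangMills.Theorems.BalabanUVNodesN15PerCubeGreenNodeGradient
import Summits.QuantumFields.YangMills.Theorems.BalabanUVNodesN15PerCubeGreenNodeObjectsAdjoint
import Summits.QuantumFields.YangMills.Theorems.BalabanUVNodesN15PerCubeGreenAdjointTwoGridNamedReg335HolderRate
import HarnessLib

/-!
# N15 = NE2, road (c) — PROGRAMME (PC), (PC-E-K-N): ★★★★ `T4EtaRate.NE2PlusOperator` BY NAME FOR THE NAMED SCALAR COVARIANT GREEN's FUNCTION FAMILY ON THE PRINTED PER-CUBE CLASS WITH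
# ALL FOUR ENTRIES OF [B9] (3.42) CONSTRUCTED AND PROVED — `G′`, `D_{U,μ₀}G′`, `G′D*_{U,ν}`, `Δ_{R_U}G′` (n15-c∕392, n15-c∕420, n15-c∕435, n15-c∕396: THE inverses `(Δ_{R_U} + aQ′_TᵀQ′_T)⁻¹`,
# no gauge choice, NO displayed entry), `M = L^m` LIVE (dag-n15-c g38, n15-c∕436)

Cell `pub-ymgap`, seat `pub-ymgap-dag-n15-c` (generation g38; R134 (a) seat, strategy s1 «first missing estimate»; HUMAN RULING D-0062; chair R424 venue).
`bears_on: R4∕N15 · K3⁸ SpineGivenEndpointR13SepCoPHV (stmt-QuantumFields-27366)`; filed `--kind proof --supports stmt-QuantumFields-27366 --as helper` — COUNT-NEUTRAL.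
THREE theorems, 0 `def`, 0 `sorry`: ★★★ `pcEntry2_hasMaj_reg335` (n15-c∕422's displayed entry-2 hypothesis `hE` PRODUCED from n15-c∕435 ★★★★ `uN_idef_scGreenOpAdj_of_reg910_rate` — the scalar step
of n15-c∕398∕422 for one more entry), ★★★★ `ne2PlusOperator_pc` = n15-c∕422 `ne2PlusOperator_pc₀₁₃` at the quadruple whose entry 2 is `pcEntry2 ν` with `hE` discharged, and the corollary
★★★ `ne2ZeroOperator_pc`.  Imports BY NAME n15-c∕422 `…PerCubeGreenNodeGradient`, n15-c∕436a `…PerCubeGreenNodeObjectsAdjoint` (`pcEntry2`, `pcFamily₂`), n15-c∕435.  Generator HOME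
`tools/g38/build_436.py`.  Nothing in the tree is modified, no landed name re-declared.

THE THEOREM `ne2PlusOperator_pc`.  For odd `L ≥ 7`, `a₀ > 0` (King's mass window), `c₃₅ > 0`, `c₄r ≥ 0`, `β₀ > 0`, trace-form-orthonormal coordinates `e` of `𝔲(m)` (`m ≥ 1`), directions
`μ₀`, `ν`: `T4EtaRate.NE2PlusOperator c₃₅ (pcInstance d mm ι c₄r β₀ hL) (fun i => pcFamily₂ d mm ι a₀ e c₄r β₀ hL i μ₀ ν)` — the family whose ENTRY 0 is the two-grid η-defect through
`τ_{Ad∘U′}` of THE fine scalar covariant Green's function `(Δ_{R_U′} + a′Q′_TᵀQ′_T)⁻¹` against THE coarse one at the straight holonomies, ENTRY 1 the same for `D_{U,μ₀}∘G′` (one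
direction), ENTRY 2 the same for `G′∘D*_{U,ν}` (one direction, adjoint arrangement, n15-c∕435), ENTRY 3 the same for `Δ_{R_U}∘G′` — ALL FOUR PROVED with NO displayed row from ONE
[B11] Thm 1 (9)–(10) datum per cube, uniformly in the fine spacing.  Constants as n15-c∕422 with `hE`'s five numbers supplied by `pcEntry2_hasMaj_reg335`:
`M₁ := max w₇ 1`, `δ₁ := δ₇∕16`, `a₁ := c₇∕(2c₃₅S + 1)`, `γ₁ := min(1∕4, β₀)`, `B₁ := max D₇ 0·(1 + κ_e·m·R(c₃₅a₁))(1 + 2^{β₀}) + 1`.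

HONEST FRAMING ∕ LIMITS.  Packaging + real bookkeeping over landed theorems; MODEL family: THE scalar covariant Green's function `G′(U)` of the (PC) chain (n15-b's covariant Laplacian species
(3.50) at `Ad∘U` + Bałaban's covariant averaging summand `a·Q′_TᵀQ′_T`, King's doubled-torus cover, one cube scale `ξ = 1`, straight-holonomy pairing; the (3.35) constant tied to the
cover's size parameter `M = L^m`); the class is dag-n07-a's typed `Reg910Cube` ([B11] Thm 1 (9)–(10) per cube) as a HYPOTHESIS on the configuration (its production = nodes N04∕N07, NOT
claimed); entries 1 and 2 read one direction at a time.  This is the SHAPE of [B9] Thm 3.1∕3.14 for `G′`, NOT the printed theorems; nothing of [B9]∕[B11] asserted.  NE2⁺ NOT PRINTED ∕ NOT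
proved as printed; N15 of record untouched (DISCHARGED AS CONSUMED, p687738); K3⁸ OPEN; counts of record UNMOVED (typed 28∕28 · discharged 8∕27); one finite 𝕋⁴ at fixed ε per index — NOT
infinite volume, NOT OS on ℝ⁴, NOT a mass gap, NOT Clay.  Restate-immune (no Theses import).
-/

set_option autoImplicit false

noncomputable section

open scoped BigOperators Matrix Matrix.Norms.L2Operator

namespace Summit.QuantumFields.YangMills.BalabanUVNodes.N15.Gluing

open Literature.MathematicalPhysics.QuantumFieldTheory.Balaban1983to89
open Literature.MathematicalPhysics.QuantumFieldTheory.Balaban1983to89.B5Prop11Plancherel (Tor fine unitVec)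
open Literature.MathematicalPhysics.QuantumFieldTheory.Balaban1983to89.B11SectG (BlockNorm HasMaj)
open Literature.MathematicalPhysics.QuantumFieldTheory.Balaban1983to89.T4EtaRate (NE2PlusOperator EtaRateIneq342 rateFactor rateFactor_nonneg)
open Literature.MathematicalPhysics.QuantumFieldTheory.Balaban1983to89.T4EtaRateDefect (idef rateWeight)
open Literature.MathematicalPhysics.QuantumFieldTheory.Balaban1983to89.B6UnitTorusCarrier (unitTorusGeo)
open Literature.MathematicalPhysics.QuantumFieldTheory.King1986 (aK)
open Literature.MathematicalPhysics.QuantumFieldTheory.King1986.Torus (tdistT tdistT_nonneg)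
open Literature.Barriers.QuantumFields (traceForm)
open Summit.QuantumFields.YangMills.BalabanUVNodes.N15.VectorPiece (kingPr unitTorusGeoS rateWeight_unitTorusGeoS)
open Summit.QuantumFields.YangMills.BalabanUVNodes.N15.MatrixSpecies (coordMat liftBlk basisConst basisConst_nonneg)
open Summit.QuantumFields.YangMills.BalabanUVNodes.N15.CovAvg (mprod kingSec ctauS)
open Summit.QuantumFields.YangMills.BalabanUVNodes.N15.OperatorReadout (opGeo opFamily opGeo_len rateFactor_opGeo etaRateIneq342_of_hasMaj pref4_pos)

variable {d : ℕ} {L : ℕ} [NeZero L]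

section Node

variable (d) (mm ι : Type) [Fintype mm] [DecidableEq mm] [Nonempty mm] [Fintype ι] [DecidableEq ι] (e : Matrix mm mm ℂ ≃L[ℝ] (ι → ℝ))

set_option maxHeartbeats 2400000 in
/-- ★★★ **n15-c∕422's DISPLAYED ENTRY-2 ROW, PRODUCED**: the (3.42)-shaped block majorant of `pcEntry2 ν` on the printed per-cube class, uniformly (`M₁, δ₁, a₁, B₁, γ₁ > 0`), from
n15-c∕435 ★★★★ `uN_idef_scGreenOpAdj_of_reg910_rate` by the scalar step of n15-c∕398∕422 (`(L^k)^{−1∕4} + (2L^{−k})^{β₀} ≤ (1+2^{β₀})(L^k)^{−γ}`, `R(C) ≤ R(c₃₅a₁)` by `pcRateConst_mono`,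
the smallness condition from `L^m·α₀ ≤ a₁`).  MODEL family; NOT [B9] Thm 3.1∕3.14 as printed.
[cite: Balaban1985BackgroundPropagators, Thm 3.1 p.397 (quantifier template, (3.42) entry `G′∇*_U`), Thm 3.14 pp.426–427 (difference template); Balaban1985Variational, Thm 1 (9)–(10) p.279; King1986, Prop. 3.9 (3.73) p.665 (rate factor)] -/
theorem pcEntry2_hasMaj_reg335 (hL : Odd L ∧ 1 < L) (hL7 : 7 ≤ L) {a₀ : ℝ} (ha₀ : 0 < a₀) {c35 : ℝ} (hc35 : 0 < c35) {c₄r : ℝ} (hc₄r : 0 ≤ c₄r) {β₀ : ℝ} (hβ₀ : 0 < β₀)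
    (he : ∀ A B : Matrix mm mm ℂ, traceForm A B = e A ⬝ᵥ e B) (ν : Fin (d + 1)) :
    ∃ M₁ δ₁ a₁ B₁ γ₁ : ℝ, 0 < M₁ ∧ 0 < δ₁ ∧ 0 < a₁ ∧ 0 < B₁ ∧ 0 < γ₁ ∧
      ∀ i : PcIdx d L, M₁ ≤ (L : ℝ) ^ i.mv → ∀ α₀ : ℝ, 0 < α₀ → (L : ℝ) ^ i.mv * α₀ ≤ a₁ →
        ∀ U' : Fin (d + 1) → ScX' d L i.mv i.kk i.r hL → (Matrix mm mm ℂ)ˣ, (pcInstance d mm ι c₄r β₀ hL i).Bf.Reg335 c35 α₀ U' → ∀ n : Fin 4, n = 2 →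
          HasMaj (BlockNorm.ofBlocks (pcGeo d hL i) (liftBlk (scBlk d L i.mv i.kk hL) ι))
            (BlockNorm.ofBlocks (pcGeo d hL i) (liftBlk (scBlk d L i.mv i.kk hL ∘ kingPr L i.kk i.r (cvM d L i.mv i.kk hL)) ι)) ((fun (i : PcIdx d L) (_ : Fin 4) U' => pcEntry2 d mm ι a₀ e hL i ν U') i n U')
            (fun y y' => B₁ * B9.pref4 ((opGeo (pcGeo d hL i) (ScX d L i.mv i.kk hL × ι) (liftBlk (scBlk d L i.mv i.kk hL) ι)).len y) n * Real.exp (-(δ₁ * (pcGeo d hL i).dist y y')) *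
              max (rateFactor (opGeo (pcGeo d hL i) (ScX d L i.mv i.kk hL × ι) (liftBlk (scBlk d L i.mv i.kk hL) ι)) γ₁ y)
                (rateFactor (opGeo (pcGeo d hL i) (ScX d L i.mv i.kk hL × ι) (liftBlk (scBlk d L i.mv i.kk hL) ι)) γ₁ y')) := by
  obtain ⟨δ₇, w₇, c₇, D₇, hδ₇, hc₇, hD₇, H2⟩ := uN_idef_scGreenOpAdj_of_reg910_rate (d := d) hL hL7 ha₀ ι ν
  have hLpos : 0 < L := Nat.pos_of_ne_zero (NeZero.ne L)
  have hLr : (0 : ℝ) < (L : ℝ) := Nat.cast_pos.mpr hLpos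
  have hL1 : (1 : ℝ) ≤ (L : ℝ) := by exact_mod_cast hLpos
  have hκ0 : 0 ≤ @basisConst ι _ (Matrix mm mm ℂ) Matrix.frobeniusNormedAddCommGroup Matrix.frobeniusNormedSpace e :=
    @basisConst_nonneg ι _ (Matrix mm mm ℂ) Matrix.frobeniusNormedAddCommGroup Matrix.frobeniusNormedSpace e
  obtain ⟨S, hS⟩ : ∃ S : ℝ, S = (1 + @basisConst ι _ (Matrix mm mm ℂ) Matrix.frobeniusNormedAddCommGroup Matrix.frobeniusNormedSpace e * (2 * Real.sqrt (Fintype.card mm)) * Real.sqrt (Fintype.card mm)) ^ 2 := ⟨_, rfl⟩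
  have hS0 : 0 ≤ S := by rw [hS]; positivity
  obtain ⟨a₁, ha₁⟩ : ∃ a₁ : ℝ, a₁ = c₇ / (2 * c35 * S + 1) := ⟨_, rfl⟩
  have ha₁pos : 0 < a₁ := by rw [ha₁]; positivity
  have ha₁c : 2 * c35 * S * a₁ ≤ c₇ := by
    rw [ha₁]
    have hden : 0 < 2 * c35 * S + 1 := by positivity
    calc 2 * c35 * S * (c₇ / (2 * c35 * S + 1)) = c₇ * (2 * c35 * S) / (2 * c35 * S + 1) := by ring
      _ ≤ c₇ * (2 * c35 * S + 1) / (2 * c35 * S + 1) := by gcongr; linarith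
      _ = c₇ := by field_simp
  obtain ⟨Cm, hCm⟩ : ∃ Cm : ℝ, Cm = c35 * a₁ := ⟨_, rfl⟩
  have hCm0 : 0 ≤ Cm := by rw [hCm]; positivity
  obtain ⟨Rm, hRm⟩ : ∃ Rm : ℝ, Rm = (4 * (c₄r * Cm) * ((1 : ℝ) ^ (2 + β₀))⁻¹ * Real.exp (5 * (Cm / 1))) + ((2 * ((d + 1 : ℕ) : ℝ) + 2) * ((Cm / 1 ^ 2) ^ 2 * Real.exp (2 * (Cm / 1))) +
      8 * ((Cm / 1) * (Cm / 1 ^ 2) * Real.exp (2 * (Cm / 1))) + 8 * ((Cm / 1) * (Cm / 1 ^ 2) * Real.exp (5 * (Cm / 1)))) := ⟨_, rfl⟩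
  have hRm0 : 0 ≤ Rm := by
    have : (0 : ℝ) < ((1 : ℝ) ^ (2 + β₀))⁻¹ := by rw [Real.one_rpow, inv_one]; exact one_pos
    rw [hRm]; positivity
  obtain ⟨K, hK⟩ : ∃ K : ℝ, K = (1 + @basisConst ι _ (Matrix mm mm ℂ) Matrix.frobeniusNormedAddCommGroup Matrix.frobeniusNormedSpace e * Fintype.card mm * Rm) * (1 + (2 : ℝ) ^ β₀) := ⟨_, rfl⟩
  have hK0 : 0 ≤ K := by rw [hK]; positivity
  let γ : ℝ := min (1 / 4 : ℝ) β₀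
  have hγ : 0 < γ := lt_min (by norm_num) hβ₀
  let B₁ : ℝ := max D₇ 0 * K + 1
  have hB₁ : 0 < B₁ := add_pos_of_nonneg_of_pos (mul_nonneg (le_max_right _ _) hK0) one_pos
  refine ⟨max w₇ 1, δ₇ / 16, a₁, B₁, γ, lt_of_lt_of_le one_pos (le_max_right _ _), by positivity, ha₁pos, hB₁, hγ, fun i hM α₀ hα₀ hMa U' hU' n hn => ?_⟩
  subst hn
  have hw₇ : w₇ ≤ ((L ^ i.mv : ℕ) : ℝ) := by push_cast; exact (le_max_left _ _).trans hM
  obtain ⟨hU'g, h910⟩ := (pcInstance_reg335_iff d mm ι c₄r β₀ hL i c35 α₀ U').1 hU'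
  have hC0 : 0 ≤ c35 * (L : ℝ) ^ i.mv * α₀ := by positivity
  have hCle : c35 * (L : ℝ) ^ i.mv * α₀ ≤ Cm := by
    rw [hCm, mul_assoc]; exact mul_le_mul_of_nonneg_left hMa hc35.le
  have hC₄0 : 0 ≤ c₄r * (c35 * (L : ℝ) ^ i.mv * α₀) := mul_nonneg hc₄r hC0
  have hsm7 : (1 + @basisConst ι _ (Matrix mm mm ℂ) Matrix.frobeniusNormedAddCommGroup Matrix.frobeniusNormedSpace e * (2 * Real.sqrt (Fintype.card mm)) * Real.sqrt (Fintype.card mm)) ^ 2 *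
      (c35 * (L : ℝ) ^ i.mv * α₀ / 1 + c35 * (L : ℝ) ^ i.mv * α₀ / 1 ^ 2) ≤ c₇ := by
    rw [← hS, div_one, one_pow, div_one]
    calc S * (c35 * (L : ℝ) ^ i.mv * α₀ + c35 * (L : ℝ) ^ i.mv * α₀) ≤ S * (Cm + Cm) := by gcongr
      _ = 2 * c35 * S * a₁ := by rw [hCm]; ring
      _ ≤ c₇ := ha₁c
  have hη0 : (0 : ℝ) ≤ (pcGeo d hL i).eta := by
    show (0 : ℝ) ≤ ((L : ℝ) ^ i.kk)⁻¹
    positivity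
  have hx1 : (1 : ℝ) ≤ (L : ℝ) ^ i.kk := one_le_pow₀ hL1
  have hxpos : (0 : ℝ) < (L : ℝ) ^ i.kk := pow_pos hLr _
  have hrf : ∀ y : (pcGeo d hL i).Site, ∀ γ' : ℝ, rateFactor (opGeo (pcGeo d hL i) (ScX d L i.mv i.kk hL × ι) (liftBlk (scBlk d L i.mv i.kk hL) ι)) γ' y = ((L : ℝ) ^ i.kk) ^ (-γ') :=
    fun y γ' => sfGeo_rateFactor d hL i.toSf _ γ' y
  have hγ4 : γ ≤ 1 / 4 := min_le_left _ _
  have hγβ : γ ≤ β₀ := min_le_right _ _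
  have hrpos : 0 ≤ ((L : ℝ) ^ i.kk) ^ (-γ) := Real.rpow_nonneg hxpos.le _
  have hηeq : ((((L ^ i.kk : ℕ) : ℝ))⁻¹) = ((L : ℝ) ^ i.kk)⁻¹ := by rw [Nat.cast_pow]
  have hsum : ((L : ℝ) ^ i.kk) ^ (-(1 / 4 : ℝ)) + (2 * ((((L ^ i.kk : ℕ) : ℝ))⁻¹)) ^ β₀ ≤ (1 + (2 : ℝ) ^ β₀) * ((L : ℝ) ^ i.kk) ^ (-γ) := by
    have h14 : ((L : ℝ) ^ i.kk) ^ (-(1 / 4 : ℝ)) ≤ ((L : ℝ) ^ i.kk) ^ (-γ) := Real.rpow_le_rpow_of_exponent_le hx1 (by linarith)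
    have hβ' : (2 * ((((L ^ i.kk : ℕ) : ℝ))⁻¹)) ^ β₀ ≤ (2 : ℝ) ^ β₀ * ((L : ℝ) ^ i.kk) ^ (-γ) := by
      rw [hηeq, Real.mul_rpow (by norm_num) (inv_nonneg.mpr hxpos.le), Real.inv_rpow hxpos.le, ← Real.rpow_neg hxpos.le]
      exact mul_le_mul_of_nonneg_left (Real.rpow_le_rpow_of_exponent_le hx1 (by linarith)) (Real.rpow_nonneg (by norm_num) _)
    have := add_le_add h14 hβ'; linarith
  have hsum0 : 0 ≤ ((L : ℝ) ^ i.kk) ^ (-(1 / 4 : ℝ)) + (2 * ((((L ^ i.kk : ℕ) : ℝ))⁻¹)) ^ β₀ := by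
    have : 0 ≤ (2 * ((((L ^ i.kk : ℕ) : ℝ))⁻¹)) ^ β₀ := Real.rpow_nonneg (by rw [hηeq]; positivity) _
    have : 0 ≤ ((L : ℝ) ^ i.kk) ^ (-(1 / 4 : ℝ)) := Real.rpow_nonneg hxpos.le _
    linarith
  have hRle : (4 * (c₄r * (c35 * (L : ℝ) ^ i.mv * α₀)) * ((1 : ℝ) ^ (2 + β₀))⁻¹ * Real.exp (5 * (c35 * (L : ℝ) ^ i.mv * α₀ / 1))) +
      ((2 * ((d + 1 : ℕ) : ℝ) + 2) * ((c35 * (L : ℝ) ^ i.mv * α₀ / 1 ^ 2) ^ 2 * Real.exp (2 * (c35 * (L : ℝ) ^ i.mv * α₀ / 1))) +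
        8 * ((c35 * (L : ℝ) ^ i.mv * α₀ / 1) * (c35 * (L : ℝ) ^ i.mv * α₀ / 1 ^ 2) * Real.exp (2 * (c35 * (L : ℝ) ^ i.mv * α₀ / 1))) +
        8 * ((c35 * (L : ℝ) ^ i.mv * α₀ / 1) * (c35 * (L : ℝ) ^ i.mv * α₀ / 1 ^ 2) * Real.exp (5 * (c35 * (L : ℝ) ^ i.mv * α₀ / 1)))) ≤ Rm := by
    rw [hRm]; exact pcRateConst_mono (Nat.cast_nonneg _) hc₄r hC0 hCle
  have hKle : (1 + @basisConst ι _ (Matrix mm mm ℂ) Matrix.frobeniusNormedAddCommGroup Matrix.frobeniusNormedSpace e * Fintype.card mm *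
      ((4 * (c₄r * (c35 * (L : ℝ) ^ i.mv * α₀)) * ((1 : ℝ) ^ (2 + β₀))⁻¹ * Real.exp (5 * (c35 * (L : ℝ) ^ i.mv * α₀ / 1))) +
      ((2 * ((d + 1 : ℕ) : ℝ) + 2) * ((c35 * (L : ℝ) ^ i.mv * α₀ / 1 ^ 2) ^ 2 * Real.exp (2 * (c35 * (L : ℝ) ^ i.mv * α₀ / 1))) +
        8 * ((c35 * (L : ℝ) ^ i.mv * α₀ / 1) * (c35 * (L : ℝ) ^ i.mv * α₀ / 1 ^ 2) * Real.exp (2 * (c35 * (L : ℝ) ^ i.mv * α₀ / 1))) +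
        8 * ((c35 * (L : ℝ) ^ i.mv * α₀ / 1) * (c35 * (L : ℝ) ^ i.mv * α₀ / 1 ^ 2) * Real.exp (5 * (c35 * (L : ℝ) ^ i.mv * α₀ / 1)))))) *
      (((L : ℝ) ^ i.kk) ^ (-(1 / 4 : ℝ)) + (2 * ((((L ^ i.kk : ℕ) : ℝ))⁻¹)) ^ β₀) ≤ K * ((L : ℝ) ^ i.kk) ^ (-γ) := by
    rw [hK, mul_assoc (1 + _ * _ * Rm)]
    refine mul_le_mul ?_ hsum hsum0 (by positivity)
    have := mul_le_mul_of_nonneg_left hRle (mul_nonneg hκ0 (Nat.cast_nonneg (Fintype.card mm)))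
    linarith
  have hd0 : ∀ y y' : (pcGeo d hL i).Site, 0 ≤ (pcGeo d hL i).dist y y' := fun y y' => sfGeo_dist_nonneg d hL i.toSf y y'
  have key := hasMaj_unitTorusGeoS (d := d) (L := L) ((L : ℝ) ^ i.mv)
    (H2 i.mv i.kk i.r i.one_le_kk i.one_le_r hw₇ e he U' hU'g
      (fun k => {z : ScX' d L i.mv i.kk i.r hL | ∃ y ∈ cvSk d L i.mv i.kk hL k, (unitTorusGeo L i.kk (cvM d L i.mv i.kk hL)).dist (scBlk' d L i.mv i.kk i.r hL z) y ≤ 5})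
      1 (c35 * (L : ℝ) ^ i.mv * α₀) β₀ (c₄r * (c35 * (L : ℝ) ^ i.mv * α₀)) one_pos hC0 hβ₀.le hC₄0 hsm7 h910 (fun k z hz => hz))
  show HasMaj _ _ (pcEntry2 d mm ι a₀ e hL i ν U') _
  unfold pcEntry2
  refine key.mono fun y y' => ?_
  rw [opGeo_len, sfGeo_len d hL i.toSf y, hrf y γ, hrf y' γ, max_self]
  have hpref : (1 : ℝ) ≤ B9.pref4 (1 : ℝ) 2 := by simp [B9.pref4]
  have hexp : Real.exp (-(δ₇ / 16 * (unitTorusGeo L i.kk (cvM d L i.mv i.kk hL)).dist y y')) ≤ Real.exp (-(δ₇ / 16 * (pcGeo d hL i).dist y y')) :=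
    Real.exp_le_exp.mpr (neg_le_neg (mul_le_mul_of_nonneg_right le_rfl (hd0 y y')))
  have hE0 : 0 ≤ Real.exp (-(δ₇ / 16 * (unitTorusGeo L i.kk (cvM d L i.mv i.kk hL)).dist y y')) := Real.exp_nonneg _
  have hmid0 : 0 ≤ (1 + @basisConst ι _ (Matrix mm mm ℂ) Matrix.frobeniusNormedAddCommGroup Matrix.frobeniusNormedSpace e * Fintype.card mm *
      ((4 * (c₄r * (c35 * (L : ℝ) ^ i.mv * α₀)) * ((1 : ℝ) ^ (2 + β₀))⁻¹ * Real.exp (5 * (c35 * (L : ℝ) ^ i.mv * α₀ / 1))) +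
      ((2 * ((d + 1 : ℕ) : ℝ) + 2) * ((c35 * (L : ℝ) ^ i.mv * α₀ / 1 ^ 2) ^ 2 * Real.exp (2 * (c35 * (L : ℝ) ^ i.mv * α₀ / 1))) +
        8 * ((c35 * (L : ℝ) ^ i.mv * α₀ / 1) * (c35 * (L : ℝ) ^ i.mv * α₀ / 1 ^ 2) * Real.exp (2 * (c35 * (L : ℝ) ^ i.mv * α₀ / 1))) +
        8 * ((c35 * (L : ℝ) ^ i.mv * α₀ / 1) * (c35 * (L : ℝ) ^ i.mv * α₀ / 1 ^ 2) * Real.exp (5 * (c35 * (L : ℝ) ^ i.mv * α₀ / 1)))))) *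
      (((L : ℝ) ^ i.kk) ^ (-(1 / 4 : ℝ)) + (2 * ((((L ^ i.kk : ℕ) : ℝ))⁻¹)) ^ β₀) := by
    have : (0 : ℝ) < ((1 : ℝ) ^ (2 + β₀))⁻¹ := by rw [Real.one_rpow, inv_one]; exact one_pos
    positivity
  calc D₇ * (1 + @basisConst ι _ (Matrix mm mm ℂ) Matrix.frobeniusNormedAddCommGroup Matrix.frobeniusNormedSpace e * Fintype.card mm *
          ((4 * (c₄r * (c35 * (L : ℝ) ^ i.mv * α₀)) * ((1 : ℝ) ^ (2 + β₀))⁻¹ * Real.exp (5 * (c35 * (L : ℝ) ^ i.mv * α₀ / 1))) +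
          ((2 * ((d + 1 : ℕ) : ℝ) + 2) * ((c35 * (L : ℝ) ^ i.mv * α₀ / 1 ^ 2) ^ 2 * Real.exp (2 * (c35 * (L : ℝ) ^ i.mv * α₀ / 1))) +
            8 * ((c35 * (L : ℝ) ^ i.mv * α₀ / 1) * (c35 * (L : ℝ) ^ i.mv * α₀ / 1 ^ 2) * Real.exp (2 * (c35 * (L : ℝ) ^ i.mv * α₀ / 1))) +
            8 * ((c35 * (L : ℝ) ^ i.mv * α₀ / 1) * (c35 * (L : ℝ) ^ i.mv * α₀ / 1 ^ 2) * Real.exp (5 * (c35 * (L : ℝ) ^ i.mv * α₀ / 1)))))) *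
          (((L : ℝ) ^ i.kk) ^ (-(1 / 4 : ℝ)) + (2 * ((((L ^ i.kk : ℕ) : ℝ))⁻¹)) ^ β₀) * Real.exp (-(δ₇ / 16 * (unitTorusGeo L i.kk (cvM d L i.mv i.kk hL)).dist y y'))
      ≤ max D₇ 0 * (K * ((L : ℝ) ^ i.kk) ^ (-γ)) * Real.exp (-(δ₇ / 16 * (unitTorusGeo L i.kk (cvM d L i.mv i.kk hL)).dist y y')) := by
        refine mul_le_mul_of_nonneg_right ?_ hE0
        rw [mul_assoc D₇]
        exact (mul_le_mul_of_nonneg_right (le_max_left D₇ 0) hmid0).trans (mul_le_mul_of_nonneg_left hKle (le_max_right _ _))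
    _ ≤ max D₇ 0 * (K * ((L : ℝ) ^ i.kk) ^ (-γ)) * Real.exp (-(δ₇ / 16 * (pcGeo d hL i).dist y y')) := mul_le_mul_of_nonneg_left hexp (by positivity)
    _ = (max D₇ 0 * K) * 1 * Real.exp (-(δ₇ / 16 * (pcGeo d hL i).dist y y')) * ((L : ℝ) ^ i.kk) ^ (-γ) := by ring
    _ ≤ B₁ * B9.pref4 (1 : ℝ) 2 * Real.exp (-(δ₇ / 16 * (pcGeo d hL i).dist y y')) * ((L : ℝ) ^ i.kk) ^ (-γ) := by
        refine mul_le_mul_of_nonneg_right (mul_le_mul_of_nonneg_right ?_ (Real.exp_nonneg _)) hrpos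
        exact mul_le_mul (by show max D₇ 0 * K ≤ max D₇ 0 * K + 1; linarith) hpref zero_le_one hB₁.le

set_option maxHeartbeats 800000 in
/-- ★★★★ **NE2⁺, OPERATOR LAYER, BY NAME, FOR THE NAMED SCALAR COVARIANT GREEN's FUNCTION FAMILY ON THE PRINTED PER-CUBE CLASS — ALL FOUR ENTRIES OF [B9] (3.42) CONSTRUCTED AND
PROVED (`G′`, `D_{U,μ₀}G′`, `G′D*_{U,ν}`, `Δ_{R_U}G′`), `M = L^m` LIVE.**  n15-c∕422 `ne2PlusOperator_pc₀₁₃` at the quadruple whose entry 2 is `pcEntry2 ν`, its displayed hypothesis `hE`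
discharged by `pcEntry2_hasMaj_reg335` (n15-c∕435).  See the module docstring for the reading, the constants and the limits.  MODEL family; NOT [B9] Thm 3.1∕3.14 as printed.
[cite: Balaban1985BackgroundPropagators, Thm 3.1 p.397 (quantifier template «M ≥ M₁ … Mα₀ ≤ a₀», (3.42) entries 0–3), Thm 3.14 pp.426–427 (difference template), (3.24)–(3.25) p.394, (3.35)–(3.36) p.396;
Balaban1985Variational, Thm 1 (9)–(10) p.279; King1986, Prop. 3.9 (3.73) p.665 (rate factor), Lemma 4.5 (4.38) p.674 (A = 0 template)] -/
theorem ne2PlusOperator_pc (hL : Odd L ∧ 1 < L) (hL7 : 7 ≤ L) {a₀ : ℝ} (ha₀ : 0 < a₀) {c35 : ℝ} (hc35 : 0 < c35) {c₄r : ℝ} (hc₄r : 0 ≤ c₄r) {β₀ : ℝ} (hβ₀ : 0 < β₀)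
    (he : ∀ A B : Matrix mm mm ℂ, traceForm A B = e A ⬝ᵥ e B) (μ₀ ν : Fin (d + 1)) :
    NE2PlusOperator c35 (pcInstance d mm ι c₄r β₀ hL) (fun i => pcFamily₂ d mm ι a₀ e c₄r β₀ hL i μ₀ ν) :=
  ne2PlusOperator_pc₀₁₃ d mm ι e hL hL7 ha₀ hc35 hc₄r hβ₀ he μ₀ (fun i _ U' => pcEntry2 d mm ι a₀ e hL i ν U') (pcEntry2_hasMaj_reg335 d mm ι e hL hL7 ha₀ hc35 hc₄r hβ₀ he ν)

/-- ★★★ **NE2⁰, OPERATOR LAYER, BY NAME** for the named family with all four entries constructed — `T4EtaRate.ne2Zero_of_ne2Plus` on `ne2PlusOperator_pc` and the inhabited class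
(n15-c∕398 `pcInstance_reg335_one`). [cite: King1986, Props. 3.8–3.9 (3.71)–(3.75) pp.664–665 (A = 0 model); Balaban1985BackgroundPropagators, Thm 3.1 p.397 (template)] -/
theorem ne2ZeroOperator_pc (hL : Odd L ∧ 1 < L) (hL7 : 7 ≤ L) {a₀ : ℝ} (ha₀ : 0 < a₀) {c35 : ℝ} (hc35 : 0 < c35) {c₄r : ℝ} (hc₄r : 0 < c₄r) {β₀ : ℝ} (hβ₀ : 0 < β₀)
    (he : ∀ A B : Matrix mm mm ℂ, traceForm A B = e A ⬝ᵥ e B) (μ₀ ν : Fin (d + 1)) :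
    T4EtaRate.NE2ZeroOperator (pcInstance d mm ι c₄r β₀ hL) (fun i => pcFamily₂ d mm ι a₀ e c₄r β₀ hL i μ₀ ν) :=
  T4EtaRate.ne2Zero_of_ne2Plus (fun i _ hα₀ => pcInstance_reg335_one d mm ι hL hc₄r i hc35 hα₀) (ne2PlusOperator_pc d mm ι e hL hL7 ha₀ hc35 hc₄r.le hβ₀ he μ₀ ν)

end Node

end Summit.QuantumFields.YangMills.BalabanUVNodes.N15.Gluing

end
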